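import Summits.AtomisticToContinuum.FouriersLaw.Theorems.EmbeddedDrudeMourreAbelThermodynamicLimitAnchoredKubo
import HarnessLib

/-!
# Stub A `stub_anchoredDcLimitOfRegularity` of line `loomis-compact-horizon-witness` (rev 4) — PROVED
(crux `EmbeddedDrudeMourre.AbelThermodynamicLimit`, item stmt-AtomisticToContinuum-12596; `--supports` file proving
the registered stub A VERBATIM; closes nothing)

**The anchored DC value converges, and so does the Abel function, from uniform Abelian regularity (R) and
fixed-frequency matching.** For `P = pinnedChain ω₂ lam β γ` (all `> 0`) and `T > 0` write
`c_N(t) = ∫ J · P_t J dμ_{N,T}` (`J = Σ_i j_i` the total current of the open `N`-chain, constructed kernels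
`transitionKernel N T T t`, Gibbs measure `gibbsMeasure N T`), `F_N(ν) = ∫₀^∞ e^{-νt} c_N(t) dt` and
`A_N(0) = Σ_k ∫₀^∞ ⟨j_{c_N}(0) j_k(t)⟩_{N,T} dt` (central bond `c_N = ⌊(N-1)/2⌋`, junk `0` for `N < 2`).
IF (R) `∀ ε > 0 ∃ ν₀ > 0 ∀ ν ∈ (0, ν₀)`, eventually in `N`, `|∫₀^∞ (1 - e^{-νt}) c_N(t) dt| ≤ ε N`, and
(M) `F_N(ν)/N → Ahat ν` for every `ν > 0`, THEN `∃ L, A_N(0) → L ∧ Ahat ν → L (ν ↓ 0)`.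

Proof (this file, sorry-free):
* §1 two real-variable lemmas: a sequence `b` with `|b_N - Ahat ν| ≤ ε` eventually, for all small `ν`,
  is Cauchy, and its limit `L` is the limit of `Ahat` at `0⁺` (`exists_tendsto_of_eventually_abs_sub_le`);
  hence sequences `a, Φ` with `|(N-1) a_N - Φ_N(ν)| ≤ ε N` eventually (small `ν`) and `Φ_N(ν)/N → Ahat ν`
  have `a_N → L`, `Ahat → L` (`exists_tendsto_of_flat_abel`, via `b_N = (N-1) a_N / N` and `N/(N-1) → 1`);
* §2 at fixed `N ≥ 2`: `c_N` is integrable on `(0,∞)` (`integral_crossCorr_total_eq_integral_mul_kubo`, landed)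
  and DC-flatness `(N-1) · A_N(0) = ∫₀^∞ c_N` (`anchoredKubo_core_of_summedKubo`, landed, with
  `D := ∫₀^∞ c_N / ((N-1) T²)`), so `∫₀^∞ (1 - e^{-νt}) c_N = (N-1) A_N(0) - F_N(ν)`;
* §3 the stub: §2 turns (R) into the hypothesis of §1 with `a = A(0)`, `Φ = F`.
References: Kundu–Dhar–Narayan 2009 (arXiv:0809.4543) eqs. (8)–(15) (DC-flatness). No definitions.
-/

noncomputable section

open MeasureTheory Filter Topology Set
open scoped NNReal

namespace Summit.AtomisticToContinuum.FouriersLaw.Theorems.AbelThermodynamicLimit.LoomisCompactHorizonWitness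

open Literature.MathematicalPhysics.KineticTheory.HeatConduction
open Summit.AtomisticToContinuum.FouriersLaw.Theorems.LightConeBondHeat
open Summit.AtomisticToContinuum.FouriersLaw.Theorems.OddSectorIrreversibility.Corrector

/-! ## §1 Real-variable lemmas: uniform approximation at small frequency ⇒ common limit -/

/-- If for every `ε > 0` there is `ν₀ > 0` such that for all `ν ∈ (0, ν₀)`, eventually in `N`,
`|b_N - Ahat ν| ≤ ε`, then `b` converges (it is Cauchy) and `Ahat → lim b` as `ν ↓ 0`. [folklore] -/
theorem exists_tendsto_of_eventually_abs_sub_le {b : ℕ → ℝ} {Ahat : ℝ → ℝ}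
    (h : ∀ ε : ℝ, 0 < ε → ∃ ν₀ : ℝ, 0 < ν₀ ∧ ∀ ν : ℝ, 0 < ν → ν < ν₀ →
      ∀ᶠ N : ℕ in atTop, |b N - Ahat ν| ≤ ε) :
    ∃ L : ℝ, Tendsto b atTop (𝓝 L) ∧ Tendsto Ahat (𝓝[>] 0) (𝓝 L) := by
  -- `b` is Cauchy
  have hC : CauchySeq b := by
    refine Metric.cauchySeq_iff'.2 fun ε hε => ?_
    obtain ⟨ν₀, hν₀, hν⟩ := h (ε / 3) (by positivity)
    obtain ⟨N₀, hN₀⟩ := (hν (ν₀ / 2) (by positivity) (by linarith)).exists_forall_of_atTop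
    refine ⟨N₀, fun n hn => ?_⟩
    rw [Real.dist_eq]
    have h1 := hN₀ n hn
    have h2 := hN₀ N₀ le_rfl
    calc |b n - b N₀| ≤ |b n - Ahat (ν₀ / 2)| + |Ahat (ν₀ / 2) - b N₀| := abs_sub_le _ _ _
      _ = |b n - Ahat (ν₀ / 2)| + |b N₀ - Ahat (ν₀ / 2)| := by rw [abs_sub_comm (Ahat _)]
      _ < ε := by linarith
  obtain ⟨L, hL⟩ := cauchySeq_tendsto_of_complete hC
  refine ⟨L, hL, Metric.tendsto_nhdsWithin_nhds.2 fun ε hε => ?_⟩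
  obtain ⟨ν₀, hν₀, hν⟩ := h (ε / 2) (half_pos hε)
  refine ⟨ν₀, hν₀, fun ν hν0 hνd => ?_⟩
  rw [Real.dist_eq, sub_zero, abs_of_pos (Set.mem_Ioi.1 hν0)] at hνd
  obtain ⟨N, hN1, hN2⟩ :=
    ((hν ν (Set.mem_Ioi.1 hν0) hνd).and (hL.eventually (Metric.ball_mem_nhds L (half_pos hε)))).exists
  have hN2' : dist (b N) L < ε / 2 := hN2
  rw [Real.dist_eq] at hN2'
  rw [Real.dist_eq]
  calc |Ahat ν - L| ≤ |Ahat ν - b N| + |b N - L| := abs_sub_le _ _ _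
    _ = |b N - Ahat ν| + |b N - L| := by rw [abs_sub_comm (Ahat _)]
    _ < ε := by linarith

/-- If `|(N-1) a_N - Φ_N(ν)| ≤ ε N` eventually in `N` for all `ν ∈ (0, ν₀(ε))`, and
`Φ_N(ν)/N → Ahat ν` for every `ν > 0`, then `a_N → L` and `Ahat ν → L` (`ν ↓ 0`) for some `L`:
the normalised sequence `b_N = (N-1) a_N / N` satisfies the previous lemma, and `N/(N-1) → 1`.
[folklore] -/
theorem exists_tendsto_of_flat_abel {a : ℕ → ℝ} {Φ : ℕ → ℝ → ℝ} {Ahat : ℝ → ℝ}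
    (h1 : ∀ ε : ℝ, 0 < ε → ∃ ν₀ : ℝ, 0 < ν₀ ∧ ∀ ν : ℝ, 0 < ν → ν < ν₀ →
      ∀ᶠ N : ℕ in atTop, |((N : ℝ) - 1) * a N - Φ N ν| ≤ ε * N)
    (h2 : ∀ ν : ℝ, 0 < ν → Tendsto (fun N : ℕ => Φ N ν / (N : ℝ)) atTop (𝓝 (Ahat ν))) :
    ∃ L : ℝ, Tendsto a atTop (𝓝 L) ∧ Tendsto Ahat (𝓝[>] 0) (𝓝 L) := by
  -- the normalised sequence `b_N = (N-1) a_N / N`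
  set b : ℕ → ℝ := fun N => ((N : ℝ) - 1) * a N / N with hb
  have hbA : ∀ ε : ℝ, 0 < ε → ∃ ν₀ : ℝ, 0 < ν₀ ∧ ∀ ν : ℝ, 0 < ν → ν < ν₀ →
      ∀ᶠ N : ℕ in atTop, |b N - Ahat ν| ≤ ε := by
    intro ε hε
    obtain ⟨ν₀, hν₀, hν⟩ := h1 (ε / 2) (half_pos hε)
    refine ⟨ν₀, hν₀, fun ν hν0 hνν₀ => ?_⟩
    have h3 : ∀ᶠ N : ℕ in atTop, Φ N ν / (N : ℝ) ∈ Metric.ball (Ahat ν) (ε / 2) :=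
      (h2 ν hν0).eventually (Metric.ball_mem_nhds _ (half_pos hε))
    filter_upwards [hν ν hν0 hνν₀, h3, eventually_gt_atTop 0] with N hA hB hN
    have hN' : (0 : ℝ) < N := by exact_mod_cast hN
    have hA' : |b N - Φ N ν / N| ≤ ε / 2 := by
      rw [hb, ← sub_div, abs_div, abs_of_pos hN', div_le_iff₀ hN']
      exact hA
    rw [Metric.mem_ball, Real.dist_eq] at hB
    calc |b N - Ahat ν| ≤ |b N - Φ N ν / N| + |Φ N ν / N - Ahat ν| := abs_sub_le _ _ _
      _ ≤ ε := by linarith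
  obtain ⟨L, hbL, hAL⟩ := exists_tendsto_of_eventually_abs_sub_le hbA
  refine ⟨L, ?_, hAL⟩
  -- `a_N = b_N · N/(N-1)` for `N ≥ 2`, and `N/(N-1) → 1`
  have hq : Tendsto (fun N : ℕ => (N : ℝ) / ((N : ℝ) - 1)) atTop (𝓝 1) := by
    simpa only [sub_eq_add_neg] using tendsto_natCast_div_add_atTop (-1 : ℝ)
  have hab := hbL.mul hq
  rw [mul_one] at hab
  refine hab.congr' ?_
  filter_upwards [eventually_ge_atTop 2] with N hN
  have hN1 : (N : ℝ) - 1 ≠ 0 := by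
    have : (2 : ℝ) ≤ N := by exact_mod_cast hN
    exact ne_of_gt (by linarith)
  have hN0 : (N : ℝ) ≠ 0 := by
    have : (2 : ℝ) ≤ N := by exact_mod_cast hN
    exact ne_of_gt (by linarith)
  rw [hb]
  field_simp

/-! ## §2 Fixed `N ≥ 2`: integrability of `c_N` on `(0,∞)`, DC-flatness, and the Abel split -/

section Flatness

variable {N : ℕ} {ω₂ lam β γ : ℝ} (hω : 0 < ω₂) (hl : 0 < lam) (hβ : 0 < β) (hγ : 0 < γ)
  {T : ℝ} (hT : 0 < T)
include hω hl hβ hγ hT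

/-- **DC-flatness of the anchored DC value (fixed `N ≥ 2`, `T > 0`).** The total-current autocorrelation
`c_N(t) = ∫ J · P_t J dμ_{N,T}` is integrable on `(0, ∞)`, and
`(N-1) · Σ_k ∫₀^∞ ⟨j_{c_N}(0) j_k(t)⟩_{N,T} dt = ∫₀^∞ c_N(t) dt` at the central bond `c_N = ⌊(N-1)/2⌋`
(`anchoredKubo_core_of_summedKubo` with `D := ∫₀^∞ c_N / ((N-1)T²)`).
[cite: KunduDharNarayan2009, eqs. (8)–(15)] -/
theorem anchoredDc_flat (hN : 2 ≤ N) :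
    IntegrableOn (fun t : ℝ =>
      ∫ z, (∑ i : Fin N, (pinnedChain ω₂ lam β γ).bondCurrent N i z) *
        (∫ y, (∑ i : Fin N, (pinnedChain ω₂ lam β γ).bondCurrent N i y)
          ∂((pinnedChain ω₂ lam β γ).transitionKernel N T T t.toNNReal z))
        ∂((pinnedChain ω₂ lam β γ).gibbsMeasure N T)) (Ioi 0) ∧
    ((N : ℝ) - 1) * (∑ k : Fin N, ∫ t in Ioi (0 : ℝ),
      ∫ z, (pinnedChain ω₂ lam β γ).bondCurrent N ⟨(N - 1) / 2, by omega⟩ z *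
        (∫ y, (pinnedChain ω₂ lam β γ).bondCurrent N k y
          ∂((pinnedChain ω₂ lam β γ).transitionKernel N T T t.toNNReal z))
      ∂((pinnedChain ω₂ lam β γ).gibbsMeasure N T)) =
    ∫ t in Ioi (0 : ℝ),
      ∫ z, (∑ i : Fin N, (pinnedChain ω₂ lam β γ).bondCurrent N i z) *
        (∫ y, (∑ i : Fin N, (pinnedChain ω₂ lam β γ).bondCurrent N i y)
          ∂((pinnedChain ω₂ lam β γ).transitionKernel N T T t.toNNReal z))
        ∂((pinnedChain ω₂ lam β γ).gibbsMeasure N T) := by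
  have hN0 : 0 < N := by omega
  have hN1 : (N : ℝ) - 1 ≠ 0 := by
    have : (2 : ℝ) ≤ N := by exact_mod_cast hN
    exact ne_of_gt (by linarith)
  have hT0 : T ≠ 0 := hT.ne'
  obtain ⟨hϑ0, -⟩ := quarter_inv_temp_admissible hT
  obtain ⟨M, -, hJM⟩ := abs_totalBondCurrent_le_exp hω.le hl.le hβ.le γ N hϑ0
  have hJc := continuous_totalBondCurrent ω₂ lam β γ N
  refine ⟨(integral_crossCorr_total_eq_integral_mul_kubo hω hl hβ hγ hN0 hT hJc hJM).1, ?_⟩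
  set I : ℝ := ∫ t in Ioi (0 : ℝ),
      ∫ z, (∑ i : Fin N, (pinnedChain ω₂ lam β γ).bondCurrent N i z) *
        (∫ y, (∑ i : Fin N, (pinnedChain ω₂ lam β γ).bondCurrent N i y)
          ∂((pinnedChain ω₂ lam β γ).transitionKernel N T T t.toNNReal z))
        ∂((pinnedChain ω₂ lam β γ).gibbsMeasure N T) with hI
  have hK : ((N : ℝ) - 1) * T ^ 2 * (I / (((N : ℝ) - 1) * T ^ 2)) = I := by
    field_simp
  have h := anchoredKubo_core_of_summedKubo hω hl hβ hγ hT hN hK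
  rw [← h, ← mul_assoc]
  exact hK

/-- **The Abel split (fixed `N ≥ 2`, `T > 0`, `ν ≥ 0`).**
`∫₀^∞ (1 - e^{-νt}) c_N(t) dt = (N-1) · A_N(0) - ∫₀^∞ e^{-νt} c_N(t) dt`: both `c_N` and `e^{-νt} c_N`
(`|e^{-νt}| ≤ 1` on `t > 0`) are integrable on `(0,∞)`, and DC-flatness. [folklore] -/
theorem integral_one_sub_exp_mul_autocorr (hN : 2 ≤ N) {ν : ℝ} (hν : 0 ≤ ν) :
    ∫ t in Set.Ioi (0:ℝ), (1 - Real.exp (-(ν * t))) *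
        ∫ z, (∑ i : Fin N, (pinnedChain ω₂ lam β γ).bondCurrent N i z) *
          (∫ y, (∑ i : Fin N, (pinnedChain ω₂ lam β γ).bondCurrent N i y)
            ∂((pinnedChain ω₂ lam β γ).transitionKernel N T T t.toNNReal z))
          ∂((pinnedChain ω₂ lam β γ).gibbsMeasure N T) =
    ((N : ℝ) - 1) * (∑ k : Fin N, ∫ t in Set.Ioi (0 : ℝ),
      ∫ z, (pinnedChain ω₂ lam β γ).bondCurrent N ⟨(N - 1) / 2, by omega⟩ z *
        (∫ y, (pinnedChain ω₂ lam β γ).bondCurrent N k y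
          ∂((pinnedChain ω₂ lam β γ).transitionKernel N T T t.toNNReal z))
      ∂((pinnedChain ω₂ lam β γ).gibbsMeasure N T)) -
    MeasureTheory.integral (MeasureTheory.volume.restrict (Set.Ioi (0:ℝ))) (fun t : ℝ =>
      Real.exp (-(ν * t)) *
        ∫ z, (∑ i : Fin N, (pinnedChain ω₂ lam β γ).bondCurrent N i z) *
          (∫ y, (∑ i : Fin N, (pinnedChain ω₂ lam β γ).bondCurrent N i y)
            ∂((pinnedChain ω₂ lam β γ).transitionKernel N T T t.toNNReal z))
          ∂((pinnedChain ω₂ lam β γ).gibbsMeasure N T)) := by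
  obtain ⟨hint, hflat⟩ := anchoredDc_flat hω hl hβ hγ hT hN
  rw [hflat]
  have hexp : Integrable (fun t : ℝ => Real.exp (-(ν * t)) *
      ∫ z, (∑ i : Fin N, (pinnedChain ω₂ lam β γ).bondCurrent N i z) *
        (∫ y, (∑ i : Fin N, (pinnedChain ω₂ lam β γ).bondCurrent N i y)
          ∂((pinnedChain ω₂ lam β γ).transitionKernel N T T t.toNNReal z))
        ∂((pinnedChain ω₂ lam β γ).gibbsMeasure N T)) (volume.restrict (Ioi (0 : ℝ))) := by
    refine Integrable.bdd_mul (c := 1) hint.integrable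
      (by fun_prop : Continuous fun t : ℝ => Real.exp (-(ν * t))).aestronglyMeasurable ?_
    refine (ae_restrict_iff' measurableSet_Ioi).2 (Eventually.of_forall fun t ht => ?_)
    rw [Real.norm_eq_abs, abs_of_pos (Real.exp_pos _)]
    exact Real.exp_le_one_iff.2 (neg_nonpos.2 (mul_nonneg hν (le_of_lt ht)))
  rw [← integral_sub hint.integrable hexp]
  refine integral_congr_ae (Eventually.of_forall fun t => ?_)
  simp only
  ring

end Flatness

/-! ## §3 The registered stub A -/

/-- **Registered stub A `stub_anchoredDcLimitOfRegularity` of line `loomis-compact-horizon-witness` (rev 4) — THE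
ANCHORED DC VALUE CONVERGES, AND SO DOES THE ABEL FUNCTION, from (R) + fixed-frequency matching** (see the module
docstring): for `P` (all `> 0`), `T > 0`, IF `|∫₀^∞ (1 - e^{-νt}) c_N| ≤ ε N` eventually in `N` for all
`ν ∈ (0, ν₀(ε))`, and `F_N(ν)/N → Ahat ν` for every `ν > 0`, THEN `∃ L, A_N(0) → L ∧ Ahat → L (ν ↓ 0)`.
DC-flatness `(N-1) A_N(0) = ∫₀^∞ c_N` (§2) + the Cauchy argument of §1.
[cite: KunduDharNarayan2009, eqs. (8)–(15)] -/
theorem stub_anchoredDcLimitOfRegularity :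
    ∀ ω₂ lam β γ : ℝ, 0 < ω₂ → 0 < lam → 0 < β → 0 < γ → ∀ T : ℝ, 0 < T →
      (∀ ε : ℝ, 0 < ε → ∃ ν₀ : ℝ, 0 < ν₀ ∧ ∀ ν : ℝ, 0 < ν → ν < ν₀ → ∃ N₀ : ℕ, ∀ N : ℕ, N₀ ≤ N →
        |∫ t in Set.Ioi (0:ℝ), (1 - Real.exp (-(ν * t))) *
            ∫ z, (∑ i : Fin N, (Literature.MathematicalPhysics.KineticTheory.HeatConduction.pinnedChain
                    ω₂ lam β γ).bondCurrent N i z) *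
              (∫ y, (∑ i : Fin N, (Literature.MathematicalPhysics.KineticTheory.HeatConduction.pinnedChain
                    ω₂ lam β γ).bondCurrent N i y)
                ∂((Literature.MathematicalPhysics.KineticTheory.HeatConduction.pinnedChain
                    ω₂ lam β γ).transitionKernel N T T t.toNNReal z))
              ∂((Literature.MathematicalPhysics.KineticTheory.HeatConduction.pinnedChain
                    ω₂ lam β γ).gibbsMeasure N T)| ≤ ε * N) →
      ∀ Ahat : ℝ → ℝ,
        (∀ ν : ℝ, 0 < ν →
          Filter.Tendsto (fun N : ℕ =>
              MeasureTheory.integral (MeasureTheory.volume.restrict (Set.Ioi (0:ℝ))) (fun t : ℝ =>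
                Real.exp (-(ν * t)) *
                  ∫ z, (∑ i : Fin N, (Literature.MathematicalPhysics.KineticTheory.HeatConduction.pinnedChain
                    ω₂ lam β γ).bondCurrent N i z) *
              (∫ y, (∑ i : Fin N, (Literature.MathematicalPhysics.KineticTheory.HeatConduction.pinnedChain
                    ω₂ lam β γ).bondCurrent N i y)
                ∂((Literature.MathematicalPhysics.KineticTheory.HeatConduction.pinnedChain
                    ω₂ lam β γ).transitionKernel N T T t.toNNReal z))
              ∂((Literature.MathematicalPhysics.KineticTheory.HeatConduction.pinnedChain
                    ω₂ lam β γ).gibbsMeasure N T)) / (N : ℝ))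
            Filter.atTop (nhds (Ahat ν))) →
        ∃ L : ℝ,
          Filter.Tendsto (fun N : ℕ =>
              if hN : 2 ≤ N then
                ∑ k : Fin N, ∫ t in Set.Ioi (0 : ℝ),
              ∫ z, (Literature.MathematicalPhysics.KineticTheory.HeatConduction.pinnedChain
                      ω₂ lam β γ).bondCurrent N ⟨(N - 1) / 2, by omega⟩ z *
                (∫ y, (Literature.MathematicalPhysics.KineticTheory.HeatConduction.pinnedChain
                      ω₂ lam β γ).bondCurrent N k y
                  ∂((Literature.MathematicalPhysics.KineticTheory.HeatConduction.pinnedChain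
                      ω₂ lam β γ).transitionKernel N T T t.toNNReal z))
              ∂((Literature.MathematicalPhysics.KineticTheory.HeatConduction.pinnedChain
                      ω₂ lam β γ).gibbsMeasure N T)
              else 0)
            Filter.atTop (nhds L) ∧
          Filter.Tendsto Ahat (nhdsWithin (0:ℝ) (Set.Ioi 0)) (nhds L) := by
  intro ω₂ lam β γ hω hl hβ hγ T hT hR Ahat hM
  refine exists_tendsto_of_flat_abel ?_ hM
  intro ε hε
  obtain ⟨ν₀, hν₀, hν⟩ := hR ε hε
  refine ⟨ν₀, hν₀, fun ν hν0 hνν₀ => ?_⟩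
  obtain ⟨N₀, hN₀⟩ := hν ν hν0 hνν₀
  filter_upwards [eventually_ge_atTop N₀, eventually_ge_atTop 2] with N hNN₀ hN2
  rw [dif_pos hN2, ← integral_one_sub_exp_mul_autocorr hω hl hβ hγ hT hN2 hν0.le]
  exact hN₀ N hNN₀

end Summit.AtomisticToContinuum.FouriersLaw.Theorems.AbelThermodynamicLimit.LoomisCompactHorizonWitness

end
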